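import Literature.NumberTheory.LFunctions.OneLevelDensityDirichletFamily
import Literature.NumberTheory.LFunctions.RHWave0
import HarnessLib

/-!
# Non-vanishing of `L(1/2, χ)` and one-level density for Dirichlet `L`-functions along SHORT
# averages of the modulus (Basak, arXiv:2409.12474v2, Theorems 1.1–1.3)

Topic `Literature/NumberTheory/LFunctions` (namespace `Literature.NumberTheory.LFunctions`,
sub-namespace `Basak2025`). STATEMENT LAYER (D-0014: sorry-free named `Prop` facts, nothing
asserted), typed for sub-cell C (literature harvest) of the cell `landau-siegel` (rung F-S3;
HOME/lit/r1/ROWS.md rows r1-T11v2 / r1-T14 / r1-T15). These are the only printed statements in which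
the family of primitive Dirichlet characters is averaged over a SHORT WINDOW of moduli
`|q − Q| ≤ Q^{1−η₁}` (optionally restricted to an arithmetic progression `q ≡ a (mod D)`,
`D ≤ Q^{η₂}`) rather than over all `q ≍ Q`: Theorem 1.1 (non-vanishing proportion `c(η₁,η₂) − ε`
with `c → 1/2`, unconditionally), Theorem 1.2 (one-level density with Fourier support beyond the
"diagonal" range `(−2, 2)`, unconditionally) and Theorem 1.3 (non-vanishing proportion
`1/2 + c*(η₁,η₂) − ε > 1/2` UNDER GRH). Theorems in print (arXiv preprint, version 2 of
2025-11-10), typed as named facts; not conjectures and not claims about Landau–Siegel zeros or about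
the manuscript arXiv:2211.02515. Companions in the tree: the full-average one-level density facts
`OneLevelDensity.hughesRudnick2003_theorem31`, `OneLevelDensity.drappeauPrattRadziwill2023_theorem1`
(support `2 + 50/1093`), whose vocabulary (`testFn`, `linearStatistic`) is reused verbatim.

## What the source prints (arXiv:2409.12474v2, D. Basak, *Non-vanishing and one level density for
## Dirichlet `L`-functions along short averages*, TeX source of v2 read 2026-08-26, §1.1)

"Suppose `Q > 0` be sufficiently large, `η₁, η₂ ≥ 0` and let `T = Q^{η₁}`. We will work with the
function `𝓗_T` periodic mod `1` and which on `[−1/2, 1/2]` is given by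
`𝓗_T(t) = T(1 − T|t|)` for `|t| ≤ 1/T`, `0` for `1/T ≤ |t| ≤ 1/2`. (1.2)

**Theorem 1.1.** Let `η₁, η₂ ≥ 0` be fixed such that `9η₁ + η₂ < 1/16`. Then there exists a
constant `c(η₁, η₂) > 0` depending only on `η₁` and `η₂` with the following property. Let `Ψ` be a
fixed nonnegative smooth function compactly supported in `[1/2, 3/2]` with `Ψ(1) > 0`. Consider
`a, D` and `Q ∈ ℕ` such that `1 ≤ a ≤ D ≤ Q^{η₂}` with `gcd(a, D) = 1`. Let `ε > 0`. Then for `Q`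
sufficiently large in terms of `η₁, η₂` and `ε`,
`Σ_{q ≡ a mod D} Ψ(q/Q) 𝓗_{Q^{η₁}}(q/Q) (q/φ(q)) Σ_{χ mod q primitive, L(1/2,χ) ≠ 0} 1`
`  ≥ (c(η₁, η₂) − ε) Σ_{q ≡ a mod D} Ψ(q/Q) 𝓗_{Q^{η₁}}(q/Q) (q/φ(q)) Σ_{χ mod q primitive} 1`,
… Moreover, `lim_{η₁ → 0, η₂ → 0} c(η₁, η₂) = 1/2`." The proof (§5, display (C_eta definition))
defines `c(η₁, η₂) := (1 − 2(80η₁ + 6η₂)) / (2 − 2(80η₁ + 6η₂))` (the Michel–VanderKam proportion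
`2ϑ/(1+2ϑ)` at mollifier length `ϑ = 1/2 − (80η₁ + 6η₂) − ε`).

**Theorem 1.2.** Let `η₁, η₂ ≥ 0` be fixed such that `86η₁ + 6η₂ < 50/1093`. Then there exists a
constant `c̃(η₁, η₂) > 0` … Let `Ψ` be [as above]. Suppose `φ` be a nonnegative smooth function such
that `supp φ̂ ⊂ (−2 − c̃(η₁,η₂), 2 + c̃(η₁,η₂))`. Consider `a, D` and `Q ∈ ℕ` such that
`1 ≤ a ≤ D ≤ Q^{η₂}` with `gcd(a, D) = 1`. Then as `Q → ∞`,
`Σ_{q ≡ a mod D} Ψ(q/Q) 𝓗_{Q^{η₁}}(q/Q) Σ_{χ mod q primitive} Σ_{γ_χ} φ((log Q / 2π) γ_χ)`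
`  = φ̂(0) Σ_{q ≡ a mod D} Ψ(q/Q) 𝓗_{Q^{η₁}}(q/Q) Σ_{χ mod q primitive} 1 + o(Q² D^{−1})`,
where … `1/2 + iγ_χ` denotes the non-trivial zeros of `L(s,χ)`. Since we do not assume the
Generalized Riemann Hypothesis, the `γ_χ`'s are allowed to be complex. Moreover,
`lim c̃(η₁, η₂) = 50/1093`." (§6, display (ceta definition A): `c̃(η₁,η₂) := 50/1093 − (86η₁ + 6η₂)`.)

**Theorem 1.3** (introduced by "The one-level density estimate from Theorem 1.2 allows us to
improve Theorem 1.1 under GRH, and thereby surpass the `1/2` threshold for non-vanishing while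
still considering short averages over `q`"; abstract: "we show that under the Generalized Riemann
Hypothesis, non-vanishing proportions exceeding `1/2` can be obtained while still averaging over
short ranges of `q`"). "Let `η₁, η₂ ≥ 0` be fixed such that `86η₁ + 6η₂ < 50/1093`. Then there
exists a constant `c*(η₁, η₂) > 0` … Let `Ψ` be [as above]. Consider `a, D` and `Q ∈ ℕ` such that
`1 ≤ a ≤ D ≤ Q^{η₂}` with `gcd(a, D) = 1`. Then for `Q` sufficiently large in terms of `η₁, η₂` and
`ε`, `Σ_{q ≡ a mod D} Ψ(q/Q) 𝓗_{Q^{η₁}}(q/Q) Σ_{χ mod q primitive, L(1/2,χ) ≠ 0} 1`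
`  ≥ (1/2 + c*(η₁, η₂) − ε) Σ_{q ≡ a mod D} Ψ(q/Q) 𝓗_{Q^{η₁}}(q/Q) Σ_{χ mod q primitive} 1`
… Moreover, `lim c*(η₁, η₂) = 25/2236`." (§8, display (c_3 definition):
`c*(η₁,η₂) = (50 − 1093(86η₁ + 6η₂)) / (2(2236 − 1093(86η₁ + 6η₂)))`, i.e. `c̃/(2(2 + c̃))`; the
source's intermediate expression "`1/2 + c̃/(2+c̃)`" in that display is a misprint for this value,
which alone is consistent with the stated limit `25/2236`.) Remark 1.5: the `q`-sum "is supported in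
the range `|q − Q| ≤ Q^{1−η₁}` with `q ≡ a mod D`"; "the size of the family … is reduced to around
`Q^{2−η₁−η₂}`".

## Lean rendering / design choices

* VERSION. The statements are those of arXiv **v2** (2025-11-10, sole author D. Basak); v1
  (Basak–Zaharescu, Sept. 2024) had Theorem 1.1 with the constraint `7η₁ + η₂ < 1/12` and the
  conclusion `≥ (1/2 − c − ε)…`, `c → 0`, and did not contain Theorems 1.2–1.3.
* The CONSTANTS are typed EXPLICITLY as the rational functions the proofs produce (`cNV`, `cTilde`,
  `cStar` below, each with its display cited) instead of "there exists a constant depending only on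
  `η₁, η₂`": with an explicit `c` the inequality `LHS ≥ (c − ε)·RHS` is exactly the labelled display
  the proof ends with, and the printed limits become PROVED bookkeeping lemmas (`cNV_zero_zero`,
  `cTilde_zero_zero`, `cStar_zero_zero`). Where the explicit `c − ε` happens to be `≤ 0` the inequality
  is trivially true (both sides count non-negative quantities), so this rendering never says more than
  the source proves.
* `Q ∈ ℕ` as printed; `Ψ(q/Q) = 0` unless `Q/2 ≤ q ≤ 3Q/2`, so the `q`-sum is the finite sum over
  `1 ≤ q ≤ 2Q`; "`q ≡ a mod D`" = `q % D = a % D`; "`D ≤ Q^{η₂}`" with the real power `(Q:ℝ)^η₂`.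
* `𝓗_T` (1.2) is typed as the `1`-periodic tent `tent T t = T(1 − T‖t − round t‖)` if
  `|t − round t| ≤ 1/T`, else `0` (`round` = nearest integer; on `[−1/2, 1/2]` this is (1.2)
  verbatim, and both branches vanish at `|t| = 1/T`).
* "primitive" = Mathlib `DirichletCharacter.IsPrimitive`; `L(1/2, χ)` = Mathlib
  `DirichletCharacter.LFunction χ (1/2)`; the counts are defined for every `q : ℕ` (value `0` at the
  never-occurring `q = 0`) so that they can be summed over `q` without instance bookkeeping.
* Theorem 1.2: test functions from their Fourier profile exactly as in
  `OneLevelDensityDirichletFamily.lean`: `φ = OneLevelDensity.testFn g`, `φ̂ = g ∈ C_c^∞`,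
  `φ̂(0) = g 0`; "`supp φ̂ ⊂ (−2−c̃, 2+c̃)`" (compact support inside the OPEN interval) =
  `tsupport g ⊆ [−σ, σ]` for some `σ < 2 + c̃`; "`φ` nonnegative" (on `ℝ`) = `φ(x)` real and `≥ 0`
  for real `x`; the zero sum `Σ_{γ_χ} φ((log Q/2π)γ_χ)` = `OneLevelDensity.linearStatistic χ g (log Q)`
  (all non-trivial zeros, complex `γ` allowed, with multiplicity). "`= M + o(Q² D^{−1})` as `Q → ∞`"
  for `a, D` constrained by `Q` is read UNIFORMLY in the admissible `(a, D)`: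
  `∀ ε > 0 ∃ Q₀ ∀ Q ≥ Q₀ ∀ admissible (a,D): ‖S − g(0)·N‖ ≤ ε Q²/D`.
* Theorem 1.3: the Generalized Riemann Hypothesis is the tree's
  `Literature.NumberTheory.LFunctions.GeneralizedRiemannHypothesis` (`RHWave0.lean`; all Dirichlet
  `L`-functions, open critical strip), taken as an explicit hypothesis of the fact. Note that in
  Theorem 1.3 (unlike 1.1) the printed sums carry NO weight `q/φ(q)`.
No instances, no notation; imports `OneLevelDensityDirichletFamily` (test-function / zero vocabulary)
and `RHWave0` (GRH). PROVED here (bookkeeping only): the three printed limits' values at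
`(η₁,η₂) = (0,0)`, `cNV < 1/2` off the origin on the constraint region where the denominator is
positive (`cNV_lt_half`) — the measured price of shortening the average — and `cStar_pos_iff`.

## References

* [Basak2025ShortAverages] arXiv:2409.12474v2: §1.1 (1.2), Theorems 1.1, 1.2, 1.3, Remarks 1.4–1.6;
  §5 (C_eta definition); §6 (ceta definition A); §8 (c_3 definition); abstract (GRH for Thm 1.3).
* [DrappeauPrattRadziwill2023] Theorem 1 (the full-average support `2 + 50/1093`; typed).
* [MontgomeryVaughan2007] Cor. 10.8 (zero vocabulary via `CharZeroSum`).
-/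

noncomputable section

open Finset
open scoped ContDiff

namespace Literature.NumberTheory.LFunctions

namespace Basak2025

/-! ### Weights and counts -/

/-- The `1`-periodic tent `𝓗_T` of (1.2): on `[−1/2, 1/2]`, `𝓗_T(t) = T(1 − T|t|)` for `|t| ≤ 1/T`
and `0` for `1/T ≤ |t| ≤ 1/2`; typed via the distance `|t − round t|` to the nearest integer.
[cite: Basak2025ShortAverages, §1.1 (1.2)] -/
def tent (T t : ℝ) : ℝ :=
  if |t - (round t : ℝ)| ≤ 1 / T then T * (1 - T * |t - (round t : ℝ)|) else 0

open scoped Classical in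
/-- `#{χ mod q primitive}` (`0` for `q = 0`, which never occurs in the sums below).
[cite: Basak2025ShortAverages, Theorem 1.1 (right-hand side)] -/
def primitiveCount (q : ℕ) : ℕ :=
  if hq : q = 0 then 0 else
    haveI : NeZero q := ⟨hq⟩
    (univ.filter fun χ : DirichletCharacter ℂ q => χ.IsPrimitive).card

open scoped Classical in
/-- `#{χ mod q primitive : L(1/2, χ) ≠ 0}` (`0` for `q = 0`).
[cite: Basak2025ShortAverages, Theorem 1.1 (left-hand side)] -/
def nonvanishingCount (q : ℕ) : ℕ :=
  if hq : q = 0 then 0 else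
    haveI : NeZero q := ⟨hq⟩
    (univ.filter fun χ : DirichletCharacter ℂ q => χ.IsPrimitive ∧ χ.LFunction (1 / 2) ≠ 0).card

open scoped Classical in
/-- `Σ_{χ mod q primitive} Σ_{γ_χ} φ((log-scale L / 2π) γ_χ)` with `φ = testFn g`: the sum over the
primitive characters mod `q` of the tree's `OneLevelDensity.linearStatistic χ g L` (`0` for `q = 0`).
[cite: Basak2025ShortAverages, Theorem 1.2 (left-hand side)] -/
def primitiveLinearStatistic (q : ℕ) (g : ℝ → ℂ) (L : ℝ) : ℂ :=
  if hq : q = 0 then 0 else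
    haveI : NeZero q := ⟨hq⟩
    ∑ χ : DirichletCharacter ℂ q with χ.IsPrimitive, OneLevelDensity.linearStatistic χ g L

/-- The short, progression-restricted weighted modulus sum
`Σ_{q ≡ a mod D} Ψ(q/Q) 𝓗_{Q^{η₁}}(q/Q) · F(q)` (real-valued `F`); since `Ψ` is supported in
`[1/2, 3/2]` only `1 ≤ q ≤ 2Q` can contribute. [cite: Basak2025ShortAverages, Theorems 1.1–1.3] -/
def shortSum (Ψ : ℝ → ℝ) (η₁ : ℝ) (Q a D : ℕ) (F : ℕ → ℝ) : ℝ :=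
  ∑ q ∈ Icc 1 (2 * Q),
    if q % D = a % D then
      Ψ ((q : ℝ) / Q) * tent ((Q : ℝ) ^ η₁) ((q : ℝ) / Q) * F q
    else 0

/-- The same sum for complex-valued `F` (used for the zero statistics of Theorem 1.2).
[cite: Basak2025ShortAverages, Theorem 1.2] -/
def shortSumC (Ψ : ℝ → ℝ) (η₁ : ℝ) (Q a D : ℕ) (F : ℕ → ℂ) : ℂ :=
  ∑ q ∈ Icc 1 (2 * Q),
    if q % D = a % D then
      ((Ψ ((q : ℝ) / Q) * tent ((Q : ℝ) ^ η₁) ((q : ℝ) / Q) : ℝ) : ℂ) * F q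
    else 0

/-- The admissible weights `Ψ`: "a fixed nonnegative smooth function compactly supported in
`[1/2, 3/2]` with `Ψ(1) > 0`". [cite: Basak2025ShortAverages, Theorem 1.1] -/
def AdmissibleWeight (Ψ : ℝ → ℝ) : Prop :=
  ContDiff ℝ ∞ Ψ ∧ (∀ x, 0 ≤ Ψ x) ∧ tsupport Ψ ⊆ Set.Icc (1 / 2 : ℝ) (3 / 2) ∧ 0 < Ψ 1

/-- The admissible progression data at scale `Q`: `1 ≤ a ≤ D ≤ Q^{η₂}`, `gcd(a, D) = 1`.
[cite: Basak2025ShortAverages, Theorem 1.1] -/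
def AdmissibleAP (η₂ : ℝ) (Q a D : ℕ) : Prop :=
  1 ≤ a ∧ a ≤ D ∧ (D : ℝ) ≤ (Q : ℝ) ^ η₂ ∧ Nat.Coprime a D

/-! ### The explicit constants of the proofs -/

/-- `c(η₁,η₂) := (1 − 2(80η₁ + 6η₂)) / (2 − 2(80η₁ + 6η₂))` — the Michel–VanderKam proportion
`2ϑ/(1+2ϑ)` at mollifier length `ϑ = 1/2 − (80η₁+6η₂)`.
[cite: Basak2025ShortAverages, §5 proof of Theorem 1.1, display (C_eta definition)] -/
def cNV (η₁ η₂ : ℝ) : ℝ :=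
  (1 - 2 * (80 * η₁ + 6 * η₂)) / (2 - 2 * (80 * η₁ + 6 * η₂))

/-- `c̃(η₁,η₂) := 50/1093 − (86η₁ + 6η₂)` — the excess of the admissible Fourier support over `2`.
[cite: Basak2025ShortAverages, §6, display (ceta definition A)] -/
def cTilde (η₁ η₂ : ℝ) : ℝ := 50 / 1093 - (86 * η₁ + 6 * η₂)

/-- `c*(η₁,η₂) = (50 − 1093(86η₁+6η₂)) / (2(2236 − 1093(86η₁+6η₂)))` (`= c̃/(2(2+c̃))`).
[cite: Basak2025ShortAverages, §8, display (c_3 definition)] -/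
def cStar (η₁ η₂ : ℝ) : ℝ :=
  (50 - 1093 * (86 * η₁ + 6 * η₂)) / (2 * (2236 - 1093 * (86 * η₁ + 6 * η₂)))

end Basak2025

open Basak2025

/-! ### The named facts -/

/-- **Basak, arXiv:2409.12474v2, Theorem 1.1** (non-vanishing of `L(1/2, χ)` along short averages
of the modulus, unconditionally): for `η₁, η₂ ≥ 0` with `9η₁ + η₂ < 1/16`, `Ψ ≥ 0` smooth supported
in `[1/2, 3/2]` with `Ψ(1) > 0`, and `ε > 0`, for all sufficiently large `Q ∈ ℕ` and all
`1 ≤ a ≤ D ≤ Q^{η₂}`, `gcd(a,D) = 1`: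
`Σ_{q ≡ a (D)} Ψ(q/Q) 𝓗_{Q^{η₁}}(q/Q) (q/φ(q)) #{χ primitive (q): L(1/2,χ) ≠ 0}`
`  ≥ (c(η₁,η₂) − ε) · Σ_{q ≡ a (D)} Ψ(q/Q) 𝓗_{Q^{η₁}}(q/Q) (q/φ(q)) #{χ primitive (q)}`,
with the proof's explicit `c = cNV η₁ η₂ → 1/2` (see `Basak2025.cNV_zero_zero`). NAMED FACT
(theorem in print, preprint v2), not proved here.
[cite: Basak2025ShortAverages, Theorem 1.1 and (C_eta definition)] -/
def basak2025_theorem11 : Prop :=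
  ∀ η₁ η₂ : ℝ, 0 ≤ η₁ → 0 ≤ η₂ → 9 * η₁ + η₂ < 1 / 16 →
    ∀ Ψ : ℝ → ℝ, AdmissibleWeight Ψ → ∀ ε : ℝ, 0 < ε →
      ∃ Q₀ : ℕ, ∀ Q : ℕ, Q₀ ≤ Q → ∀ a D : ℕ, AdmissibleAP η₂ Q a D →
        (cNV η₁ η₂ - ε) *
            shortSum Ψ η₁ Q a D (fun q => (q : ℝ) / (Nat.totient q : ℝ) * (primitiveCount q : ℝ)) ≤
          shortSum Ψ η₁ Q a D (fun q => (q : ℝ) / (Nat.totient q : ℝ) * (nonvanishingCount q : ℝ))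

/-- **Basak, arXiv:2409.12474v2, Theorem 1.2** (one-level density of primitive Dirichlet
`L`-functions along short averages of the modulus, Fourier support beyond `(−2, 2)`,
unconditionally): for `η₁, η₂ ≥ 0` with `86η₁ + 6η₂ < 50/1093`, `Ψ` as above, and a nonnegative
(on `ℝ`) test function `φ = testFn g` whose Fourier profile `g ∈ C_c^∞` is supported in `[−σ, σ]`
for some `σ < 2 + c̃(η₁,η₂)`, `c̃ = 50/1093 − (86η₁+6η₂)`: uniformly for admissible `(a, D)`,
`Σ_{q ≡ a (D)} Ψ(q/Q) 𝓗_{Q^{η₁}}(q/Q) Σ_{χ primitive (q)} Σ_{γ_χ} φ((log Q/2π)γ_χ)`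
`  = φ̂(0) · Σ_{q ≡ a (D)} Ψ(q/Q) 𝓗_{Q^{η₁}}(q/Q) #{χ primitive (q)} + o(Q²/D)` as `Q → ∞`
(`γ_χ` complex allowed; `φ̂(0) = g(0)`). NAMED FACT, not proved here.
[cite: Basak2025ShortAverages, Theorem 1.2 and (ceta definition A)] -/
def basak2025_theorem12 : Prop :=
  ∀ η₁ η₂ : ℝ, 0 ≤ η₁ → 0 ≤ η₂ → 86 * η₁ + 6 * η₂ < 50 / 1093 →
    ∀ Ψ : ℝ → ℝ, AdmissibleWeight Ψ →
      ∀ g : ℝ → ℂ, ContDiff ℝ ∞ g →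
        (∃ σ : ℝ, σ < 2 + cTilde η₁ η₂ ∧ tsupport g ⊆ Set.Icc (-σ) σ) →
        (∀ x : ℝ, (OneLevelDensity.testFn g (x : ℂ)).im = 0 ∧
            0 ≤ (OneLevelDensity.testFn g (x : ℂ)).re) →
          ∀ ε : ℝ, 0 < ε → ∃ Q₀ : ℕ, ∀ Q : ℕ, Q₀ ≤ Q → ∀ a D : ℕ, AdmissibleAP η₂ Q a D →
            ‖shortSumC Ψ η₁ Q a D (fun q => primitiveLinearStatistic q g (Real.log Q)) -
                g 0 * (shortSum Ψ η₁ Q a D (fun q => (primitiveCount q : ℝ)) : ℂ)‖ ≤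
              ε * (Q : ℝ) ^ 2 / (D : ℝ)

/-- **Basak, arXiv:2409.12474v2, Theorem 1.3** (non-vanishing proportion beyond `1/2` along short
averages, UNDER the Generalized Riemann Hypothesis — the hypothesis is stated in the abstract and in
the sentence introducing the theorem): assuming GRH for Dirichlet `L`-functions, for `η₁, η₂ ≥ 0`
with `86η₁ + 6η₂ < 50/1093`, `Ψ` as above and `ε > 0`, for all sufficiently large `Q ∈ ℕ` and all
admissible `(a, D)`:
`Σ_{q ≡ a (D)} Ψ(q/Q) 𝓗_{Q^{η₁}}(q/Q) #{χ primitive (q): L(1/2,χ) ≠ 0}`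
`  ≥ (1/2 + c*(η₁,η₂) − ε) · Σ_{q ≡ a (D)} Ψ(q/Q) 𝓗_{Q^{η₁}}(q/Q) #{χ primitive (q)}`
(no `q/φ(q)` weight here), with the explicit `c* = cStar η₁ η₂ → 25/2236`. NAMED FACT, not proved
here. [cite: Basak2025ShortAverages, Theorem 1.3, (c_3 definition), abstract] -/
def basak2025_theorem13 : Prop :=
  GeneralizedRiemannHypothesis →
    ∀ η₁ η₂ : ℝ, 0 ≤ η₁ → 0 ≤ η₂ → 86 * η₁ + 6 * η₂ < 50 / 1093 →
      ∀ Ψ : ℝ → ℝ, AdmissibleWeight Ψ → ∀ ε : ℝ, 0 < ε →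
        ∃ Q₀ : ℕ, ∀ Q : ℕ, Q₀ ≤ Q → ∀ a D : ℕ, AdmissibleAP η₂ Q a D →
          (1 / 2 + cStar η₁ η₂ - ε) * shortSum Ψ η₁ Q a D (fun q => (primitiveCount q : ℝ)) ≤
            shortSum Ψ η₁ Q a D (fun q => (nonvanishingCount q : ℝ))

/-! ### Bookkeeping (proved): the printed limits and the price of a short average -/

namespace Basak2025

/-- `lim_{η₁,η₂ → 0} c(η₁,η₂) = 1/2`: the explicit `c` is continuous with value `1/2` at the origin.
[cite: Basak2025ShortAverages, Theorem 1.1 (Limit Result)] -/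
theorem cNV_zero_zero : cNV 0 0 = 1 / 2 := by norm_num [cNV]

/-- `lim c̃(η₁,η₂) = 50/1093`. [cite: Basak2025ShortAverages, Theorem 1.2 (Limit Result A)] -/
theorem cTilde_zero_zero : cTilde 0 0 = 50 / 1093 := by norm_num [cTilde]

/-- `lim c*(η₁,η₂) = 25/2236` (`= (50/1093)/(2(2 + 50/1093))`, Drappeau–Pratt–Radziwiłł's GRH
value `1 − 1/(2+κ) − 1/2` at `κ = 50/1093`). [cite: Basak2025ShortAverages, Theorem 1.3 (Limit Result C)] -/
theorem cStar_zero_zero : cStar 0 0 = 25 / 2236 := by norm_num [cStar]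

/-- The full-average edge `c̃(0,0) = 50/1093` is `OneLevelDensity.dprSupport − 2`.
[cite: Basak2025ShortAverages, §1 (comparison with Drappeau–Pratt–Radziwiłł)]
[cite: DrappeauPrattRadziwill2023, Theorem 1] -/
theorem cTilde_zero_zero_eq_dprSupport_sub_two : cTilde 0 0 = OneLevelDensity.dprSupport - 2 := by
  norm_num [cTilde, OneLevelDensity.dprSupport]

/-- THE MEASURED PRICE OF SHORTENING: whenever `0 < 80η₁ + 6η₂ < 1` (e.g. `η₁, η₂ ≥ 0` not both
zero, inside the region where the denominator is positive), the unconditional proportion `c(η₁,η₂)`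
is STRICTLY BELOW `1/2` — every genuine short window or progression restriction costs proportion at
the printed technology.
[cite: Basak2025ShortAverages, (C_eta definition) and Remark 1.5] -/
theorem cNV_lt_half {η₁ η₂ : ℝ} (hξ : 0 < 80 * η₁ + 6 * η₂)
    (hden : 80 * η₁ + 6 * η₂ < 1) : cNV η₁ η₂ < 1 / 2 := by
  unfold cNV
  have hpos : 0 < 2 - 2 * (80 * η₁ + 6 * η₂) := by linarith
  rw [div_lt_iff₀ hpos]
  nlinarith

/-- `c(η₁,η₂) ≤ 1/2` throughout `80η₁ + 6η₂ < 1`. [cite: Basak2025ShortAverages, (C_eta definition)] -/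
theorem cNV_le_half {η₁ η₂ : ℝ} (h₁ : 0 ≤ η₁) (h₂ : 0 ≤ η₂) (hden : 80 * η₁ + 6 * η₂ < 1) :
    cNV η₁ η₂ ≤ 1 / 2 := by
  unfold cNV
  have hpos : 0 < 2 - 2 * (80 * η₁ + 6 * η₂) := by linarith
  rw [div_le_iff₀ hpos]
  nlinarith

/-- Under the constraint of Theorems 1.2/1.3 the GRH-excess `c*` is positive exactly when
`c̃ > 0`, i.e. always on `86η₁ + 6η₂ < 50/1093`. [cite: Basak2025ShortAverages, (c_3 definition)] -/
theorem cStar_pos {η₁ η₂ : ℝ} (h : 86 * η₁ + 6 * η₂ < 50 / 1093) : 0 < cStar η₁ η₂ := by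
  unfold cStar
  apply div_pos <;> nlinarith

/-- `c* = c̃ / (2(2 + c̃))` (the value consistent with the printed limit `25/2236`).
[cite: Basak2025ShortAverages, (c_3 definition)] -/
theorem cStar_eq_cTilde_div {η₁ η₂ : ℝ} (h : 86 * η₁ + 6 * η₂ < 50 / 1093) :
    cStar η₁ η₂ = cTilde η₁ η₂ / (2 * (2 + cTilde η₁ η₂)) := by
  unfold cStar cTilde
  have h1 : (2 : ℝ) * (2236 - 1093 * (86 * η₁ + 6 * η₂)) ≠ 0 := by nlinarith
  have h2 : (2 : ℝ) * (2 + (50 / 1093 - (86 * η₁ + 6 * η₂))) ≠ 0 := by nlinarith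
  rw [div_eq_div_iff h1 h2]
  ring

end Basak2025

end Literature.NumberTheory.LFunctions

end
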